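import Literature.Analysis.FluidPDE.PassiveVectorTensorGalerkinTail
import Literature.Analysis.FunctionSpaces.TorusInverseLaplacian
import HarnessLib

/-!
# Weak passive-vector solutions with a constant viscosity TENSOR: the truncated energy identity
# (Fourier form) and the flux against the own truncation — tensor twin of
# `PassiveVectorGalerkinIdentity` + the flux part of `PassiveVectorGalerkinTail`

Analysis/FluidPDE proof-support file (everything proved; no definitions). For the weak class
`Torus.IsWeakTensorPassiveVectorOn A T 𝔸 b w₀ w` (`∂ₜw + (b·∇)w + A (w·∇)b + ∇π = 𝓛_𝔸 w`,
`∇·w = 0`, Frisch's anisotropic eddy viscosity (9.57)) we run the Fourier–Galerkin energy argument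
ON THE WEAK SOLUTION ITSELF, in Fourier variables on the viscous side (the symbol matrix
`T_𝔸(k) = Torus.symbT 𝔸 k` couples the components, so the dissipation at level `N` is the
symbol form `Q_N(s) = 4π² ∑_{|k|≤N} Re ⟪ŵ(s)(k), T_𝔸(k) ŵ(s)(k)⟫`, not `ν‖∇P_N w(s)‖²`):

* `ae_galerkinFlux_eq_sum` — the transport flux against the own truncation in Fourier variables:
  `∫⟪w(s),(b(s)·∇)P_N w(s)⟫ + A∫⟪b(s),(w(s)·∇)P_N w(s)⟫ = ∑_{|k|≤N} Re B_k(ŵ(s)(k))(s)` for a.e. `s`;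
* `ae_sum_sq_norm_mFourierCoeff_eq` — **the truncated energy identity**: for an `L²` weakly
  divergence-free datum, a.e. `t ∈ (0,T)` and every `N`,
  `∑_{|k|≤N} ‖ŵ(t)(k)‖² + 2∫_{(0,t]} Q_N = ∑_{|k|≤N} ‖ŵ₀(k)‖² + 2∫_{(0,t]} Flux_N`
  (the one-mode identities `PassiveVectorTensorModeEnergy.ae_sq_norm_mFourierCoeff_eq` summed over
  the frequency ball; Robinson–Rodrigo–Sadowski 2016, §4.2 (4.20), with Frisch's tensor);
* `ae_galerkinFlux_eq_remainder` — for `A = 0` and a carrier bounded by `M`: `Flux_N(s) = R_N(s) =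
  ∫⟪w(s) − P_N w(s), (b(s)·∇)P_N w(s)⟫`, `|R_N(s)| ≤ d M (∫‖w(s) − P_N w(s)‖²)^{1/2} ‖∇P_N w(s)‖₂`;
* `ae_lo_mul_le_symbForm` — **coercivity of the truncated symbol form** in a Legendre–Hadamard
  window `NearIso 𝔸 lo hi`: `lo ‖∇P_N w(s)‖₂² ≤ Q_N(s)`, and, on mean-zero slices,
  `4π² lo ∑_{|k|≤N} ‖ŵ(s)(k)‖² ≤ Q_N(s)`; `Q_N(s)` is nonnegative and nondecreasing in `N`.

Cell `ad-ideate`, tensor twin energy layer E3 (consumer: K1L `LagrangianRenormalisationStep`,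
`stub_baseT`: decay of every weak tensor-class solution, assembled in `PassiveVectorTensorEnergyDecay`).

## Mathlib / tree search

Tree: `PassiveVectorGalerkinIdentity` (`sum_mul_integral_inner_convect_eq`,
`integral_inner_convect_fourierTruncate_eq_remainder`, `abs_integral_inner_convect_le_of_norm_le`,
`gradNormSq_fourierTruncate`), `PassiveVectorFourier` (`integral_inner_convect_realTrigPoly_singleton`),
`PassiveVectorTensorModeEnergy`, `PassiveVectorTensorUniqueness` (`lo_mul_le_re_inner_symbT`),
`TorusTrigPoly` (`toReal_eGradNormSq_realTrigPoly`, `freqBall`), `TorusFourierModes` (`realTrigPoly_apply_eq_sum`),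
`TorusInverseLaplacian` (`one_le_freqNormSq_of_ne_zero`).

## References

* J. C. Robinson, J. L. Rodrigo, W. Sadowski, *The three-dimensional Navier–Stokes equations*
  (CUP 2016), §4.1–§4.2, (4.20). [`RobinsonRodrigoSadowski2016`]
* U. Frisch, *Turbulence* (CUP 1995), §9.6.3 eq. (9.57) p. 233. [`Frisch1995Turbulence`]
* M. Giaquinta, *Multiple integrals in the calculus of variations and nonlinear elliptic systems*
  (Princeton 1983), Ch. III §2 (2.2). [`Giaquinta1983MultipleIntegrals`]
* R. Temam, *Navier–Stokes Equations* (1984), Ch. III §1.1. [`Temam1984`]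
-/

noncomputable section

open MeasureTheory Set Filter Function TopologicalSpace Complex UnitAddTorus
open scoped ENNReal NNReal InnerProductSpace ComplexConjugate

namespace Literature.Analysis.FluidPDE

namespace Torus

variable {d : Type*} [Fintype d] [DecidableEq d]

/-! ## The truncation as a sum of single real modes -/

section Truncation

/-- `P_N u = ∑_{|k|≤N} Re (e_k • û(k))` as a sum of single real modes. [folklore] -/
private theorem fourierTruncate_eq_sum_singleton (N : ℕ) (u : UnitAddTorus d → EuclideanSpace ℝ d) :
    FunctionSpaces.Torus.fourierTruncate N u = fun y => ∑ k ∈ FunctionSpaces.Torus.freqBall N,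
      (1 : ℝ) • FunctionSpaces.Torus.realTrigPoly {k}
        (fun k' => mFourierCoeff (FunctionSpaces.EuclideanSpace.complexify ∘ u) k') y := by
  funext y
  rw [FunctionSpaces.Torus.fourierTruncate_eq, FunctionSpaces.Torus.realTrigPoly_apply_eq_sum]
  refine Finset.sum_congr rfl fun k _ => ?_
  rw [one_smul, FunctionSpaces.Torus.realTrigPoly_apply_eq_sum, Finset.sum_singleton]

end Truncation

namespace IsWeakTensorPassiveVectorOn

variable {A T : ℝ} {𝔸 : Visc4 d} {b w : ℝ → UnitAddTorus d → EuclideanSpace ℝ d}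
  {w₀ : UnitAddTorus d → EuclideanSpace ℝ d}

/-! ## The transport flux against the own truncation, in Fourier variables -/

/-- **The transport flux against the own truncation in Fourier variables**: for a.e. `s ∈ (0,T)`
and every `N`,
`∫⟪w(s),(b(s)·∇)P_N w(s)⟫ + A∫⟪b(s),(w(s)·∇)P_N w(s)⟫ = ∑_{|k|≤N} Re B_k(ŵ(s)(k))(s)`,
`B_k(z)(s) = ∑ⱼ 2πikⱼ ⟪𝓕(bⱼw)(s)(k), z⟫ + A ∑ⱼ 2πikⱼ ⟪𝓕(wⱼb)(s)(k), z⟫` (linearity of the trilinear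
form in the test field and the single-mode pairings). [cite: RobinsonRodrigoSadowski2016, §4.1 (Galerkin truncations)] -/
theorem ae_galerkinFlux_eq_sum (h : IsWeakTensorPassiveVectorOn A T 𝔸 b w₀ w) :
    ∀ᵐ s ∂(volume.restrict (Ioo 0 T)), ∀ N : ℕ,
      (∫ x, ⟪w s x, FunctionSpaces.Torus.convect (b s) (FunctionSpaces.Torus.fourierTruncate N (w s)) x⟫_ℝ) +
          A * ∫ x, ⟪b s x, FunctionSpaces.Torus.convect (w s) (FunctionSpaces.Torus.fourierTruncate N (w s)) x⟫_ℝ =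
        ∑ k ∈ FunctionSpaces.Torus.freqBall N,
          ((∑ j, (2 * Real.pi * I * (k j)) *
              ⟪mFourierCoeff (FunctionSpaces.EuclideanSpace.complexify ∘ fun x => b s x j • w s x) k,
                mFourierCoeff (FunctionSpaces.EuclideanSpace.complexify ∘ w s) k⟫_ℂ) +
            (A : ℂ) * ∑ j, (2 * Real.pi * I * (k j)) *
              ⟪mFourierCoeff (FunctionSpaces.EuclideanSpace.complexify ∘ fun x => w s x j • b s x) k,
                mFourierCoeff (FunctionSpaces.EuclideanSpace.complexify ∘ w s) k⟫_ℂ).re := by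
  filter_upwards [h.ae_integrable_slice] with s hs
  intro N
  set c : (d → ℤ) → EuclideanSpace ℂ d := fun k' => mFourierCoeff (FunctionSpaces.EuclideanSpace.complexify ∘ w s) k'
    with hc
  have ha : ∀ k : d → ℤ, FunctionSpaces.Torus.IsSmooth (FunctionSpaces.Torus.realTrigPoly {k} c) :=
    fun k => FunctionSpaces.Torus.isSmooth_realTrigPoly _ _
  have e1 : ∫ x, ⟪w s x, FunctionSpaces.Torus.convect (b s) (FunctionSpaces.Torus.fourierTruncate N (w s)) x⟫_ℝ =
      ∑ k ∈ FunctionSpaces.Torus.freqBall N, (∑ j, (2 * Real.pi * I * (k j)) *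
        ⟪mFourierCoeff (FunctionSpaces.EuclideanSpace.complexify ∘ fun x => b s x j • w s x) k, c k⟫_ℂ).re := by
    rw [fourierTruncate_eq_sum_singleton N (w s),
      ← sum_mul_integral_inner_convect_eq (FunctionSpaces.Torus.freqBall N) (fun _ => (1 : ℝ)) ha hs.2.1]
    refine Finset.sum_congr rfl fun k _ => ?_
    rw [one_mul, integral_inner_convect_realTrigPoly_singleton hs.2.1 k c]
  have e2 : ∫ x, ⟪b s x, FunctionSpaces.Torus.convect (w s) (FunctionSpaces.Torus.fourierTruncate N (w s)) x⟫_ℝ =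
      ∑ k ∈ FunctionSpaces.Torus.freqBall N, (∑ j, (2 * Real.pi * I * (k j)) *
        ⟪mFourierCoeff (FunctionSpaces.EuclideanSpace.complexify ∘ fun x => w s x j • b s x) k, c k⟫_ℂ).re := by
    rw [fourierTruncate_eq_sum_singleton N (w s),
      ← sum_mul_integral_inner_convect_eq (FunctionSpaces.Torus.freqBall N) (fun _ => (1 : ℝ)) ha hs.2.2]
    refine Finset.sum_congr rfl fun k _ => ?_
    rw [one_mul, integral_inner_convect_realTrigPoly_singleton hs.2.2 k c]
  rw [e1, e2, Finset.mul_sum, ← Finset.sum_add_distrib]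
  refine Finset.sum_congr rfl fun k _ => ?_
  rw [Complex.add_re, Complex.re_ofReal_mul]

/-! ## Integrability of the mode energy integrands -/

/-- The transport part of the mode energy integrand, `s ↦ Re B_k(ŵ(s)(k))(s)`, is integrable on
`(0,T)` (integrable fluxes times the essentially bounded mode). [cite: RobinsonRodrigoSadowski2016, §4.2 (Galerkin energy estimate)] -/
theorem integrableOn_modeRHS_self (h : IsWeakTensorPassiveVectorOn A T 𝔸 b w₀ w) (k : d → ℤ) :
    IntegrableOn (fun s =>
      (∑ j, (2 * Real.pi * I * (k j)) *
          ⟪mFourierCoeff (FunctionSpaces.EuclideanSpace.complexify ∘ fun x => b s x j • w s x) k,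
            mFourierCoeff (FunctionSpaces.EuclideanSpace.complexify ∘ w s) k⟫_ℂ) +
        (A : ℂ) * ∑ j, (2 * Real.pi * I * (k j)) *
          ⟪mFourierCoeff (FunctionSpaces.EuclideanSpace.complexify ∘ fun x => w s x j • b s x) k,
            mFourierCoeff (FunctionSpaces.EuclideanSpace.complexify ∘ w s) k⟫_ℂ) (Ioo 0 T) volume := by
  obtain ⟨C₁, _, hXb⟩ := h.exists_ae_norm_mFourierCoeff_le k
  have hXm : AEStronglyMeasurable (fun s => mFourierCoeff (FunctionSpaces.EuclideanSpace.complexify ∘ w s) k)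
      (volume.restrict (Ioo 0 T)) := (h.integrableOn_mFourierCoeff k).aestronglyMeasurable
  have hFi : ∀ j, IntegrableOn (fun s =>
      mFourierCoeff (FunctionSpaces.EuclideanSpace.complexify ∘ fun x => b s x j • w s x) k) (Ioo 0 T) volume :=
    fun j => h.integrableOn_mFourierCoeff_carrier_smul j k
  have hGi : ∀ j, IntegrableOn (fun s =>
      mFourierCoeff (FunctionSpaces.EuclideanSpace.complexify ∘ fun x => w s x j • b s x) k) (Ioo 0 T) volume :=
    fun j => h.integrableOn_mFourierCoeff_smul_carrier j k
  have hFX : ∀ j, IntegrableOn (fun s =>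
      ⟪mFourierCoeff (FunctionSpaces.EuclideanSpace.complexify ∘ fun x => b s x j • w s x) k,
        mFourierCoeff (FunctionSpaces.EuclideanSpace.complexify ∘ w s) k⟫_ℂ) (Ioo 0 T) volume := by
    intro j
    refine Integrable.mono' ((hFi j).norm.mul_const C₁) ((hFi j).aestronglyMeasurable.inner hXm) ?_
    filter_upwards [hXb] with s hs
    exact (norm_inner_le_norm _ _).trans (mul_le_mul_of_nonneg_left hs (norm_nonneg _))
  have hGX : ∀ j, IntegrableOn (fun s =>
      ⟪mFourierCoeff (FunctionSpaces.EuclideanSpace.complexify ∘ fun x => w s x j • b s x) k,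
        mFourierCoeff (FunctionSpaces.EuclideanSpace.complexify ∘ w s) k⟫_ℂ) (Ioo 0 T) volume := by
    intro j
    refine Integrable.mono' ((hGi j).norm.mul_const C₁) ((hGi j).aestronglyMeasurable.inner hXm) ?_
    filter_upwards [hXb] with s hs
    exact (norm_inner_le_norm _ _).trans (mul_le_mul_of_nonneg_left hs (norm_nonneg _))
  exact (integrable_finsetSum _ fun j _ => (hFX j).const_mul _).add
    ((integrable_finsetSum _ fun j _ => (hGX j).const_mul _).const_mul _)

/-- The transport flux against the own truncation is integrable on `(0,T)`.
[cite: RobinsonRodrigoSadowski2016, §4.2 (Galerkin energy estimate)] -/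
theorem integrableOn_galerkinFlux (h : IsWeakTensorPassiveVectorOn A T 𝔸 b w₀ w) (N : ℕ) :
    IntegrableOn (fun s =>
      (∫ x, ⟪w s x, FunctionSpaces.Torus.convect (b s) (FunctionSpaces.Torus.fourierTruncate N (w s)) x⟫_ℝ) +
        A * ∫ x, ⟪b s x, FunctionSpaces.Torus.convect (w s) (FunctionSpaces.Torus.fourierTruncate N (w s)) x⟫_ℝ)
      (Ioo 0 T) volume := by
  have hsum : IntegrableOn (fun s => ∑ k ∈ FunctionSpaces.Torus.freqBall N,
      ((∑ j, (2 * Real.pi * I * (k j)) *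
          ⟪mFourierCoeff (FunctionSpaces.EuclideanSpace.complexify ∘ fun x => b s x j • w s x) k,
            mFourierCoeff (FunctionSpaces.EuclideanSpace.complexify ∘ w s) k⟫_ℂ) +
        (A : ℂ) * ∑ j, (2 * Real.pi * I * (k j)) *
          ⟪mFourierCoeff (FunctionSpaces.EuclideanSpace.complexify ∘ fun x => w s x j • b s x) k,
            mFourierCoeff (FunctionSpaces.EuclideanSpace.complexify ∘ w s) k⟫_ℂ).re) (Ioo 0 T) volume :=
    integrable_finsetSum _ fun k _ => (h.integrableOn_modeRHS_self k).re
  refine hsum.congr ?_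
  filter_upwards [h.ae_galerkinFlux_eq_sum] with s hs
  exact (hs N).symm

/-- The truncated symbol form `s ↦ Q_N(s) = 4π² ∑_{|k|≤N} Re ⟪ŵ(s)(k), T_𝔸(k) ŵ(s)(k)⟫` is integrable
on `(0,T)`. [cite: Frisch1995Turbulence, §9.6.3 eq. (9.57) p. 233] -/
theorem integrableOn_symbForm (h : IsWeakTensorPassiveVectorOn A T 𝔸 b w₀ w) (N : ℕ) :
    IntegrableOn (fun s => 4 * Real.pi ^ 2 * ∑ k ∈ FunctionSpaces.Torus.freqBall N,
      (⟪mFourierCoeff (FunctionSpaces.EuclideanSpace.complexify ∘ w s) k,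
        symbT 𝔸 k (mFourierCoeff (FunctionSpaces.EuclideanSpace.complexify ∘ w s) k)⟫_ℂ).re) (Ioo 0 T) volume :=
  (integrable_finsetSum _ fun k _ => (h.integrableOn_inner_symbT k).re).const_mul _

/-! ## The truncated energy identity -/

/-- **The truncated energy identity of a weak tensor-viscosity passive-vector solution (Fourier
form).** For a datum `w₀ ∈ L²` weakly divergence free, a.e. `t ∈ (0,T)` and every `N`:
`∑_{|k|≤N} ‖ŵ(t)(k)‖² + 2 ∫_{(0,t]} Q_N(s) ds = ∑_{|k|≤N} ‖ŵ₀(k)‖² + 2 ∫_{(0,t]} Flux_N(s) ds`,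
`Q_N(s) = 4π² ∑_{|k|≤N} Re ⟪ŵ(s)(k), T_𝔸(k) ŵ(s)(k)⟫`,
`Flux_N(s) = ∫⟪w(s),(b(s)·∇)P_N w(s)⟫ + A ∫⟪b(s),(w(s)·∇)P_N w(s)⟫` — the Galerkin system tested
against its own solution, obtained by summing the one-mode identities over the frequency ball.
[cite: RobinsonRodrigoSadowski2016, §4.2 (4.20)] [cite: Frisch1995Turbulence, §9.6.3 eq. (9.57) p. 233] -/
theorem ae_sum_sq_norm_mFourierCoeff_eq (h : IsWeakTensorPassiveVectorOn A T 𝔸 b w₀ w) (hw₀ : MemLp w₀ 2 volume)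
    (hdiv₀ : FunctionSpaces.Torus.IsWeaklyDivFree w₀) :
    ∀ᵐ t ∂(volume.restrict (Ioo 0 T)), ∀ N : ℕ,
      (∑ k ∈ FunctionSpaces.Torus.freqBall N, ‖mFourierCoeff (FunctionSpaces.EuclideanSpace.complexify ∘ w t) k‖ ^ 2) +
          2 * ∫ s in Ioc 0 t, 4 * Real.pi ^ 2 * ∑ k ∈ FunctionSpaces.Torus.freqBall N,
            (⟪mFourierCoeff (FunctionSpaces.EuclideanSpace.complexify ∘ w s) k,
              symbT 𝔸 k (mFourierCoeff (FunctionSpaces.EuclideanSpace.complexify ∘ w s) k)⟫_ℂ).re =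
        (∑ k ∈ FunctionSpaces.Torus.freqBall N, ‖mFourierCoeff (FunctionSpaces.EuclideanSpace.complexify ∘ w₀) k‖ ^ 2) +
          2 * ∫ s in Ioc 0 t,
            ((∫ x, ⟪w s x, FunctionSpaces.Torus.convect (b s) (FunctionSpaces.Torus.fourierTruncate N (w s)) x⟫_ℝ) +
              A * ∫ x, ⟪b s x, FunctionSpaces.Torus.convect (w s) (FunctionSpaces.Torus.fourierTruncate N (w s)) x⟫_ℝ) := by
  -- names
  set X : (d → ℤ) → ℝ → EuclideanSpace ℂ d := fun k t =>
    mFourierCoeff (FunctionSpaces.EuclideanSpace.complexify ∘ w t) k with hX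
  set X₀ : (d → ℤ) → EuclideanSpace ℂ d := fun k =>
    mFourierCoeff (FunctionSpaces.EuclideanSpace.complexify ∘ w₀) k with hX₀
  set Bf : (d → ℤ) → ℝ → ℂ := fun k s =>
    (∑ j, (2 * Real.pi * I * (k j)) *
        ⟪mFourierCoeff (FunctionSpaces.EuclideanSpace.complexify ∘ fun x => b s x j • w s x) k, X k s⟫_ℂ) +
      (A : ℂ) * ∑ j, (2 * Real.pi * I * (k j)) *
        ⟪mFourierCoeff (FunctionSpaces.EuclideanSpace.complexify ∘ fun x => w s x j • b s x) k, X k s⟫_ℂ with hBf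
  set Vf : (d → ℤ) → ℝ → ℂ := fun k s => ⟪X k s, symbT 𝔸 k (X k s)⟫_ℂ with hVf
  set Fl : ℕ → ℝ → ℝ := fun N s =>
    (∫ x, ⟪w s x, FunctionSpaces.Torus.convect (b s) (FunctionSpaces.Torus.fourierTruncate N (w s)) x⟫_ℝ) +
      A * ∫ x, ⟪b s x, FunctionSpaces.Torus.convect (w s) (FunctionSpaces.Torus.fourierTruncate N (w s)) x⟫_ℝ with hFl
  have hBi : ∀ k, IntegrableOn (fun s => (Bf k s).re) (Ioo 0 T) volume := fun k => (h.integrableOn_modeRHS_self k).re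
  have hVi : ∀ k, IntegrableOn (fun s => (Vf k s).re) (Ioo 0 T) volume := fun k => (h.integrableOn_inner_symbT k).re
  have hHi : ∀ k, IntegrableOn (fun s => ((-(4 * Real.pi ^ 2 : ℝ) : ℂ) * Vf k s + Bf k s).re) (Ioo 0 T) volume :=
    fun k => (((h.integrableOn_inner_symbT k).const_mul _).add (h.integrableOn_modeRHS_self k)).re
  -- all one-mode identities at once, and the flux identification
  have hmodes := ae_all_iff.2 fun k => h.ae_sq_norm_mFourierCoeff_eq hw₀ hdiv₀ k
  have hflux' : ∀ᵐ s ∂(volume : Measure ℝ), s ∈ Ioo 0 T → ∀ N : ℕ,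
      Fl N s = ∑ k ∈ FunctionSpaces.Torus.freqBall N, (Bf k s).re :=
    (ae_restrict_iff' measurableSet_Ioo).1 h.ae_galerkinFlux_eq_sum
  filter_upwards [hmodes, ae_restrict_mem measurableSet_Ioo] with t ht htT
  intro N
  have hsub : Ioc 0 t ⊆ Ioo 0 T := Ioc_subset_Ioo_right htT.2
  -- sum the one-mode identities over the ball
  have hsum : ∑ k ∈ FunctionSpaces.Torus.freqBall N, ‖X k t‖ ^ 2 =
      ∑ k ∈ FunctionSpaces.Torus.freqBall N, (‖X₀ k‖ ^ 2 +
        2 * ∫ s in Ioc 0 t, ((-(4 * Real.pi ^ 2 : ℝ) : ℂ) * Vf k s + Bf k s).re) :=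
    Finset.sum_congr rfl fun k _ => ht k
  rw [Finset.sum_add_distrib, ← Finset.mul_sum,
    ← integral_finsetSum _ (fun k _ => (hHi k).mono_set hsub)] at hsum
  -- split the summed integrand
  have hsplit : ∫ s in Ioc 0 t, ∑ k ∈ FunctionSpaces.Torus.freqBall N, ((-(4 * Real.pi ^ 2 : ℝ) : ℂ) * Vf k s + Bf k s).re =
      (∫ s in Ioc 0 t, Fl N s) - ∫ s in Ioc 0 t, 4 * Real.pi ^ 2 * ∑ k ∈ FunctionSpaces.Torus.freqBall N, (Vf k s).re := by
    have hQi : IntegrableOn (fun s => 4 * Real.pi ^ 2 * ∑ k ∈ FunctionSpaces.Torus.freqBall N, (Vf k s).re)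
        (Ioc 0 t) volume := (h.integrableOn_symbForm N).mono_set hsub
    have hFli : IntegrableOn (Fl N) (Ioc 0 t) volume := (h.integrableOn_galerkinFlux N).mono_set hsub
    rw [← integral_sub hFli hQi]
    refine setIntegral_congr_ae measurableSet_Ioc ?_
    filter_upwards [hflux'] with s hs hsI
    rw [hs (hsub hsI) N, Finset.mul_sum, ← Finset.sum_sub_distrib]
    refine Finset.sum_congr rfl fun k _ => ?_
    rw [Complex.add_re, neg_mul, Complex.neg_re, Complex.re_ofReal_mul]
    ring
  rw [hsplit] at hsum
  rw [hX] at hsum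
  simp only at hsum
  linarith

/-! ## The transport flux for `A = 0`: remainder form and bound -/

/-- **The transport flux of the truncated identity, for `A = 0`, is a remainder** controlled by the
Parseval tail and the truncated dissipation: for a carrier bounded by `M` a.e., for a.e.
`s ∈ (0,T)`,
`Flux_N(s) = R_N(s) = ∫⟪w(s) - P_N w(s), (b(s)·∇)P_N w(s)⟫`,
`|R_N(s)| ≤ d M (∫‖w(s) - P_N w(s)‖²)^{1/2} (‖∇P_N w(s)‖₂²)^{1/2}`
(`∫⟪P_N w,(b·∇)P_N w⟫ = 0` for the weakly divergence-free carrier). [cite: RobinsonRodrigoSadowski2016, §4.2 (4.20)] -/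
theorem ae_galerkinFlux_eq_remainder (h : IsWeakTensorPassiveVectorOn 0 T 𝔸 b w₀ w) {M : ℝ} (hM : 0 ≤ M)
    (hbM : ∀ᵐ s ∂(volume.restrict (Ioo 0 T)), ∀ᵐ x ∂volume, ‖b s x‖ ≤ M) (N : ℕ) :
    ∀ᵐ s ∂(volume.restrict (Ioo 0 T)),
      ((∫ x, ⟪w s x, FunctionSpaces.Torus.convect (b s) (FunctionSpaces.Torus.fourierTruncate N (w s)) x⟫_ℝ) +
          (0 : ℝ) * ∫ x, ⟪b s x, FunctionSpaces.Torus.convect (w s) (FunctionSpaces.Torus.fourierTruncate N (w s)) x⟫_ℝ =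
        ∫ x, ⟪w s x - FunctionSpaces.Torus.fourierTruncate N (w s) x,
            FunctionSpaces.Torus.convect (b s) (FunctionSpaces.Torus.fourierTruncate N (w s)) x⟫_ℝ) ∧
      |∫ x, ⟪w s x - FunctionSpaces.Torus.fourierTruncate N (w s) x,
          FunctionSpaces.Torus.convect (b s) (FunctionSpaces.Torus.fourierTruncate N (w s)) x⟫_ℝ| ≤
        Fintype.card d * M * Real.sqrt (∫ x, ‖w s x - FunctionSpaces.Torus.fourierTruncate N (w s) x‖ ^ 2) *
          Real.sqrt ((FunctionSpaces.Torus.eGradNormSq (FunctionSpaces.Torus.fourierTruncate N (w s))).toReal) := by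
  filter_upwards [h.ae_integrable_slice, h.ae_memLp_two, h.ae_isWeaklyDivFree_carrier, h.ae_aestronglyMeasurable_slice, hbM]
    with s hs hs2 hbdiv hsm hbs
  have hbint : Integrable (b s) volume := Integrable.of_bound hsm.2 M hbs
  refine ⟨?_, ?_⟩
  · rw [zero_mul, add_zero, integral_inner_convect_fourierTruncate_eq_remainder hbint hbdiv hs.2.1 N]
  · have hv : MemLp (fun x => w s x - FunctionSpaces.Torus.fourierTruncate N (w s) x) 2 volume :=
      hs2.sub (FunctionSpaces.Torus.memLp_fourierTruncate N _ 2)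
    have hb := abs_integral_inner_convect_le_of_norm_le (u := b s) hv hM hbs
      (FunctionSpaces.Torus.isSmooth_fourierTruncate N (w s))
    rwa [gradNormSq_fourierTruncate] at hb

/-! ## Coercivity and monotonicity of the truncated symbol form -/

/-- **Coercivity of the truncated symbol form against the truncated dissipation.** In a window
`NearIso 𝔸 lo hi`, for a.e. `s ∈ (0,T)` and every `N`:
`lo ‖∇P_N w(s)‖₂² ≤ Q_N(s) = 4π² ∑_{|k|≤N} Re ⟪ŵ(s)(k), T_𝔸(k) ŵ(s)(k)⟫`
(`‖∇P_N w(s)‖₂² = 4π² ∑_{|k|≤N} |k|² ‖ŵ(s)(k)‖²` and `lo|k|²‖z‖² ≤ Re ⟪z, T_𝔸(k)z⟫` on `k^⊥`, where the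
modes of a weak solution lie for a.e. `s`). [cite: Giaquinta1983MultipleIntegrals, Ch. III §2 eq. (2.2)]
[cite: Frisch1995Turbulence, §9.6.3 eq. (9.57) p. 233] -/
theorem ae_lo_mul_le_symbForm (h : IsWeakTensorPassiveVectorOn A T 𝔸 b w₀ w) {lo hi : ℝ} (h𝔸 : NearIso 𝔸 lo hi) :
    ∀ᵐ s ∂(volume.restrict (Ioo 0 T)), ∀ N : ℕ,
      lo * (FunctionSpaces.Torus.eGradNormSq (FunctionSpaces.Torus.fourierTruncate N (w s))).toReal ≤
        4 * Real.pi ^ 2 * ∑ k ∈ FunctionSpaces.Torus.freqBall N,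
          (⟪mFourierCoeff (FunctionSpaces.EuclideanSpace.complexify ∘ w s) k,
            symbT 𝔸 k (mFourierCoeff (FunctionSpaces.EuclideanSpace.complexify ∘ w s) k)⟫_ℂ).re := by
  have htr := ae_all_iff.2 fun k => h.ae_sum_mul_mFourierCoeff_eq_zero k
  filter_upwards [htr, h.ae_integrable_slice] with s hs hsi
  intro N
  rw [FunctionSpaces.Torus.fourierTruncate_eq,
    FunctionSpaces.Torus.toReal_eGradNormSq_realTrigPoly FunctionSpaces.Torus.neg_mem_freqBall_of_mem
      (FunctionSpaces.Torus.isConjSymm_mFourierCoeff hsi.1),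
    ← mul_assoc, mul_comm lo, mul_assoc, Finset.mul_sum]
  refine mul_le_mul_of_nonneg_left (Finset.sum_le_sum fun k _ => ?_) (by positivity)
  exact lo_mul_le_re_inner_symbT h𝔸 (hs k)

/-- **Coercivity of the truncated symbol form against the truncated energy on mean-zero slices**:
if moreover `ŵ(s)(0) = 0`, then `4π² lo ∑_{|k|≤N} ‖ŵ(s)(k)‖² ≤ Q_N(s)` (`|k|² ≥ 1` for `k ≠ 0`).
[cite: Giaquinta1983MultipleIntegrals, Ch. III §2 eq. (2.2)] [cite: Frisch1995Turbulence, §9.6.3 eq. (9.57) p. 233] -/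
theorem ae_lo_mul_sum_sq_norm_le_symbForm (h : IsWeakTensorPassiveVectorOn A T 𝔸 b w₀ w) {lo hi : ℝ}
    (h𝔸 : NearIso 𝔸 lo hi) (hlo : 0 ≤ lo) :
    ∀ᵐ s ∂(volume.restrict (Ioo 0 T)), mFourierCoeff (FunctionSpaces.EuclideanSpace.complexify ∘ w s) 0 = 0 →
      ∀ N : ℕ, 4 * Real.pi ^ 2 * lo *
          ∑ k ∈ FunctionSpaces.Torus.freqBall N, ‖mFourierCoeff (FunctionSpaces.EuclideanSpace.complexify ∘ w s) k‖ ^ 2 ≤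
        4 * Real.pi ^ 2 * ∑ k ∈ FunctionSpaces.Torus.freqBall N,
          (⟪mFourierCoeff (FunctionSpaces.EuclideanSpace.complexify ∘ w s) k,
            symbT 𝔸 k (mFourierCoeff (FunctionSpaces.EuclideanSpace.complexify ∘ w s) k)⟫_ℂ).re := by
  have htr := ae_all_iff.2 fun k => h.ae_sum_mul_mFourierCoeff_eq_zero k
  filter_upwards [htr] with s hs
  intro h0 N
  rw [mul_assoc, Finset.mul_sum]
  refine mul_le_mul_of_nonneg_left (Finset.sum_le_sum fun k _ => ?_) (by positivity)
  by_cases hk : k = 0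
  · subst hk
    rw [h0]
    simp
  · have h1 := FunctionSpaces.Torus.one_le_freqNormSq_of_ne_zero hk
    have hco := lo_mul_le_re_inner_symbT h𝔸 (hs k)
    have hz : 0 ≤ ‖mFourierCoeff (FunctionSpaces.EuclideanSpace.complexify ∘ w s) k‖ ^ 2 := sq_nonneg _
    nlinarith [hco, h1, hz, mul_nonneg hlo hz]

/-- The terms of the symbol form are nonnegative in a window with `0 ≤ lo`: for a.e. `s`, every `k`,
`0 ≤ Re ⟪ŵ(s)(k), T_𝔸(k) ŵ(s)(k)⟫`. [cite: Giaquinta1983MultipleIntegrals, Ch. III §2 eq. (2.2)] -/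
theorem ae_re_inner_symbT_nonneg (h : IsWeakTensorPassiveVectorOn A T 𝔸 b w₀ w) {lo hi : ℝ}
    (h𝔸 : NearIso 𝔸 lo hi) (hlo : 0 ≤ lo) :
    ∀ᵐ s ∂(volume.restrict (Ioo 0 T)), ∀ k : d → ℤ,
      0 ≤ (⟪mFourierCoeff (FunctionSpaces.EuclideanSpace.complexify ∘ w s) k,
        symbT 𝔸 k (mFourierCoeff (FunctionSpaces.EuclideanSpace.complexify ∘ w s) k)⟫_ℂ).re := by
  have htr := ae_all_iff.2 fun k => h.ae_sum_mul_mFourierCoeff_eq_zero k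
  filter_upwards [htr] with s hs
  intro k
  have hco := lo_mul_le_re_inner_symbT h𝔸 (hs k)
  exact (mul_nonneg hlo (mul_nonneg (FunctionSpaces.Torus.freqNormSq_nonneg k) (sq_nonneg _))).trans hco

/-- **The truncated symbol form is nondecreasing in `N`** (nonnegative terms), for a.e. `s`.
[cite: Giaquinta1983MultipleIntegrals, Ch. III §2 eq. (2.2)] -/
theorem ae_symbForm_mono (h : IsWeakTensorPassiveVectorOn A T 𝔸 b w₀ w) {lo hi : ℝ}
    (h𝔸 : NearIso 𝔸 lo hi) (hlo : 0 ≤ lo) :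
    ∀ᵐ s ∂(volume.restrict (Ioo 0 T)), Monotone fun N : ℕ =>
      4 * Real.pi ^ 2 * ∑ k ∈ FunctionSpaces.Torus.freqBall N,
        (⟪mFourierCoeff (FunctionSpaces.EuclideanSpace.complexify ∘ w s) k,
          symbT 𝔸 k (mFourierCoeff (FunctionSpaces.EuclideanSpace.complexify ∘ w s) k)⟫_ℂ).re := by
  filter_upwards [h.ae_re_inner_symbT_nonneg h𝔸 hlo] with s hs
  intro N N' hNN'
  exact mul_le_mul_of_nonneg_left
    (Finset.sum_le_sum_of_subset_of_nonneg (FunctionSpaces.Torus.freqBall_mono hNN') fun k _ _ => hs k)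
    (by positivity)

end IsWeakTensorPassiveVectorOn

end Torus

end Literature.Analysis.FluidPDE

end
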